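import Summits.NavierStokesRegularity.FunctionalMining.TopEigHeatDanskin
import HarnessLib

/-!
# FunctionalMining — the equality clause of the selection bound (F1 PART I, Corollary 2,
# "with equality iff e attains μ(S; ΔS)")

Search for candidate a priori estimates; no regularity claim. Cell `pub-nsfunc`, prove seat
(gen 22). `TopEigHeatDanskin.lean` proves Danskin's formula
`T(v) := heatDissipation (∫(λ₁⁺)^q) v = −∫ q λ₁^{q−1} μ(S; ΔS)` and the SELECTION BOUND
`T(v) ≤ −∫ q λ₁^{q−1} eᵀ ΔS e =: ∫ ρ_e` for every a.e. selection `e(x) ∈ E(S(x))` (F1 PART I Cor. 2;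
pen, countersigned in the cell — not a cited fact). Here is its equality clause, in the precise form

* **`TopEig.heatDissipation_topEigMoment_eq_selection_iff`** —
  `T(v) = ∫ ρ_e  ↔  q λ₁(x)^{q−1} (μ(S;ΔS)(x) − e(x)ᵀΔS(x)e(x)) = 0` for a.e. `x`
  (the integrand of `∫ρ_e − T` is non-negative, so it integrates to zero iff it vanishes a.e.);
* `TopEig.selectionDefect_eq_zero_iff` — for `q > 1` and `λ ≥ 0`, `q λ^{q−1}(μ − c) = 0 ↔ λ = 0 ∨ c = μ`;
  for `q = 1` it reads `c = μ` (`TopEig.selectionDefect_eq_zero_iff_one`).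

So for `q > 1` the pen's clause "equality iff `e(x)` attains `μ(S(x); ΔS(x))` for a.e. `x`" is exact
ON `{λ₁ > 0}`: where `λ₁(x) = 0` (i.e. `S(x) = 0` for a trace-free strain, `E(S(x))` = the whole
sphere) the weight vanishes and no attainment is required; for `q = 1` attainment a.e. is necessary
and sufficient. [ours; folklore]
-/

noncomputable section

open MeasureTheory Set Filter Topology

namespace Summit.NavierStokesRegularity.FunctionalMining

open Literature.Analysis Literature.Analysis.FunctionSpaces Literature.Analysis.FluidPDE

namespace TopEig

variable {d : Type*} [Fintype d] [DecidableEq d] [Nonempty d]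
variable {v : UnitAddTorus d → EuclideanSpace ℝ d}

/-- **The equality clause of the selection bound (F1 PART I, Cor. 2).** For smooth divergence-free
`v`, `q ≥ 1`, and an a.e. selection `e(x) ∈ E(S(x))` with `q λ₁^{q−1} eᵀΔS e` integrable:
`heatDissipation (∫(λ₁⁺)^q) v = −∫ q λ₁^{q−1} eᵀΔS e` iff
`q λ₁(x)^{q−1} (μ(S(x); ΔS(x)) − e(x)ᵀΔS(x)e(x)) = 0` for a.e. `x`. [ours] -/
theorem heatDissipation_topEigMoment_eq_selection_iff {q : ℝ} (hq : 1 ≤ q) (hv : Torus.IsSmooth v)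
    (hdiv : Torus.IsDivFree v) {e : UnitAddTorus d → d → ℝ}
    (he : ∀ᵐ x, e x ∈ topEigSet (StrainL4.strainFlat v x))
    (hint : Integrable (fun x => q * torusStrainTopEig v x ^ (q - 1) *
      quad (StrainL4.strainFlat (Torus.laplacian v) x) (e x)) volume) :
    heatDissipation (torusTopEigMoment q) v =
        -∫ x, q * torusStrainTopEig v x ^ (q - 1) * quad (StrainL4.strainFlat (Torus.laplacian v) x) (e x) ↔
      ∀ᵐ x, q * torusStrainTopEig v x ^ (q - 1) *
        (dirTopEig (StrainL4.strainFlat v x) (StrainL4.strainFlat (Torus.laplacian v) x) -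
          quad (StrainL4.strainFlat (Torus.laplacian v) x) (e x)) = 0 := by
  have hD := integrable_danskinDensity hq hv hv.laplacian hdiv
  -- the defect `g = q λ₁^{q−1}(μ − eᵀΔSe) ≥ 0` a.e.
  have hg_nonneg : 0 ≤ᵐ[volume] fun x => q * torusStrainTopEig v x ^ (q - 1) *
      (dirTopEig (StrainL4.strainFlat v x) (StrainL4.strainFlat (Torus.laplacian v) x) -
        quad (StrainL4.strainFlat (Torus.laplacian v) x) (e x)) := by
    filter_upwards [he] with x hx
    have hl : 0 ≤ torusStrainTopEig v x := by
      rw [← lam_strainFlat]; exact lam_strainFlat_nonneg hv hdiv x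
    exact mul_nonneg (mul_nonneg (by linarith) (Real.rpow_nonneg hl _))
      (sub_nonneg.2 (quad_le_dirTopEig _ hx))
  have hg_int : Integrable (fun x => q * torusStrainTopEig v x ^ (q - 1) *
      (dirTopEig (StrainL4.strainFlat v x) (StrainL4.strainFlat (Torus.laplacian v) x) -
        quad (StrainL4.strainFlat (Torus.laplacian v) x) (e x))) volume := by
    have h := hD.sub hint
    refine h.congr (ae_of_all _ fun x => ?_)
    simp only [Pi.sub_apply]
    ring
  have hsplit : ∫ x, q * torusStrainTopEig v x ^ (q - 1) *
      (dirTopEig (StrainL4.strainFlat v x) (StrainL4.strainFlat (Torus.laplacian v) x) -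
        quad (StrainL4.strainFlat (Torus.laplacian v) x) (e x)) =
      (∫ x, q * torusStrainTopEig v x ^ (q - 1) *
          dirTopEig (StrainL4.strainFlat v x) (StrainL4.strainFlat (Torus.laplacian v) x)) -
        ∫ x, q * torusStrainTopEig v x ^ (q - 1) *
          quad (StrainL4.strainFlat (Torus.laplacian v) x) (e x) := by
    rw [← integral_sub hD hint]
    refine integral_congr_ae (ae_of_all _ fun x => ?_)
    ring
  have key := integral_eq_zero_iff_of_nonneg_ae hg_nonneg hg_int
  rw [hsplit] at key
  rw [heatDissipation_topEigMoment_eq_integral hq hv hdiv]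
  constructor
  · intro h
    have h0 := key.1 (by linarith)
    exact h0.mono fun x hx => by simpa using hx
  · intro h
    have h' : (fun x => q * torusStrainTopEig v x ^ (q - 1) *
        (dirTopEig (StrainL4.strainFlat v x) (StrainL4.strainFlat (Torus.laplacian v) x) -
          quad (StrainL4.strainFlat (Torus.laplacian v) x) (e x))) =ᵐ[volume] 0 :=
      h.mono fun x hx => hx
    have h0 := key.2 h'
    linarith

omit [Fintype d] [DecidableEq d] [Nonempty d] in
/-- Pointwise reading of the defect for `q > 1`, `λ ≥ 0`: `q λ^{q−1}(μ − c) = 0 ↔ λ = 0 ∨ c = μ` — where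
`λ₁ = 0` no attainment is needed. [folklore] -/
theorem selectionDefect_eq_zero_iff {q lam μ c : ℝ} (hq : 1 < q) (hlam : 0 ≤ lam) :
    q * lam ^ (q - 1) * (μ - c) = 0 ↔ lam = 0 ∨ c = μ := by
  have hq0 : q ≠ 0 := by positivity
  have hq1 : q - 1 ≠ 0 := sub_ne_zero.2 hq.ne'
  rw [mul_eq_zero, mul_eq_zero, Real.rpow_eq_zero_iff_of_nonneg hlam, sub_eq_zero]
  constructor
  · rintro ((h | ⟨h, -⟩) | h)
    · exact absurd h hq0
    · exact Or.inl h
    · exact Or.inr h.symm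
  · rintro (h | h)
    · exact Or.inl (Or.inr ⟨h, hq1⟩)
    · exact Or.inr h.symm

omit [Fintype d] [DecidableEq d] [Nonempty d] in
/-- Pointwise reading for `q = 1`: `1 · λ^0 · (μ − c) = 0 ↔ c = μ` — at `q = 1` attainment a.e. is
necessary and sufficient. [folklore] -/
theorem selectionDefect_eq_zero_iff_one {lam μ c : ℝ} :
    (1 : ℝ) * lam ^ ((1 : ℝ) - 1) * (μ - c) = 0 ↔ c = μ := by
  rw [sub_self, Real.rpow_zero, one_mul, one_mul, sub_eq_zero, eq_comm]

/-- **COROLLARY 2, EQUALITY CLAUSE, PRECISE FORM (`q > 1`).** For smooth divergence-free `v`, `q > 1`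
and an a.e. selection `e(x) ∈ E(S(x))` with `q λ₁^{q−1} eᵀΔS e` integrable:
`heatDissipation (∫(λ₁⁺)^q) v = −∫ q λ₁^{q−1} eᵀΔS e` iff for a.e. `x` WITH `λ₁(x) > 0` the selection
attains the Danskin value, `e(x)ᵀΔS(x)e(x) = μ(S(x); ΔS(x))` — the pen's "equality iff `e` attains `μ`
for a.e. `x`", exact on `{λ₁ > 0}` (gen 23 addendum). [ours; F1 PART I Cor. 2] -/
theorem heatDissipation_topEigMoment_eq_selection_iff_attains {q : ℝ} (hq : 1 < q)
    (hv : Torus.IsSmooth v) (hdiv : Torus.IsDivFree v) {e : UnitAddTorus d → d → ℝ}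
    (he : ∀ᵐ x, e x ∈ topEigSet (StrainL4.strainFlat v x))
    (hint : Integrable (fun x => q * torusStrainTopEig v x ^ (q - 1) *
      quad (StrainL4.strainFlat (Torus.laplacian v) x) (e x)) volume) :
    heatDissipation (torusTopEigMoment q) v =
        -∫ x, q * torusStrainTopEig v x ^ (q - 1) * quad (StrainL4.strainFlat (Torus.laplacian v) x) (e x) ↔
      ∀ᵐ x, 0 < torusStrainTopEig v x →
        quad (StrainL4.strainFlat (Torus.laplacian v) x) (e x) =
          dirTopEig (StrainL4.strainFlat v x) (StrainL4.strainFlat (Torus.laplacian v) x) := by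
  rw [heatDissipation_topEigMoment_eq_selection_iff hq.le hv hdiv he hint]
  have hl : ∀ x, 0 ≤ torusStrainTopEig v x := fun x => by
    rw [← lam_strainFlat]; exact lam_strainFlat_nonneg hv hdiv x
  refine Filter.eventually_congr (Eventually.of_forall fun x => ?_)
  rw [selectionDefect_eq_zero_iff hq (hl x)]
  constructor
  · rintro (h | h) hpos
    · exact absurd h hpos.ne'
    · exact h
  · intro h
    rcases (hl x).eq_or_lt with h0 | hpos
    · exact Or.inl h0.symm
    · exact Or.inr (h hpos)

/-- **COROLLARY 2, EQUALITY CLAUSE AT `q = 1`.** For smooth divergence-free `v` and an a.e. selection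
`e` with `eᵀΔS e` integrable: `heatDissipation (∫λ₁⁺) v = −∫ 1·λ₁^0·eᵀΔS e` iff `e(x)` attains
`μ(S(x); ΔS(x))` for a.e. `x` (no exceptional set at `q = 1`). [ours; F1 PART I Cor. 2] -/
theorem heatDissipation_topEigMoment_eq_selection_iff_attains_one
    (hv : Torus.IsSmooth v) (hdiv : Torus.IsDivFree v) {e : UnitAddTorus d → d → ℝ}
    (he : ∀ᵐ x, e x ∈ topEigSet (StrainL4.strainFlat v x))
    (hint : Integrable (fun x => (1 : ℝ) * torusStrainTopEig v x ^ ((1 : ℝ) - 1) *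
      quad (StrainL4.strainFlat (Torus.laplacian v) x) (e x)) volume) :
    heatDissipation (torusTopEigMoment 1) v =
        -∫ x, (1 : ℝ) * torusStrainTopEig v x ^ ((1 : ℝ) - 1) *
          quad (StrainL4.strainFlat (Torus.laplacian v) x) (e x) ↔
      ∀ᵐ x, quad (StrainL4.strainFlat (Torus.laplacian v) x) (e x) =
          dirTopEig (StrainL4.strainFlat v x) (StrainL4.strainFlat (Torus.laplacian v) x) := by
  rw [heatDissipation_topEigMoment_eq_selection_iff le_rfl hv hdiv he hint]
  exact Filter.eventually_congr (Eventually.of_forall fun x => selectionDefect_eq_zero_iff_one)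

end TopEig

end Summit.NavierStokesRegularity.FunctionalMining

end
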